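import Summits.PneNP.PneNP.Theorems.ChebyshevTracialDesignTiltedSmallBlockExpansion
import HarnessLib

/-!
# Cell pnp-psdrank, route `ChebyshevTracialDesign`: TILTED SMALL BLOCKS — one `HH`-class priced in every crossing-plane
# direction (brick 151; crux `TracialDecayExp20`, stmt-PneNP-19878)

Brick 151 (prover g30; eng MEMO-26 §4, prover MEMO-32 §8 (iii-a), MEMO-33 §1). THE PER-CLASS STATEMENT OF THE TILTED
SMALL-BLOCK LINE. After the `HH`-class split of a small block `H` at a matching `M` (eng (K0)/(T-K3); class = `f` full, `g` half
internal edges), the (CG_1′) containment form of the mask `ψ(|U∩H|)` in a TYPE-CONSTANT direction `(u₂,u₁,u₀)` restricted to the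
class is, on the reduced `π`-stable ground set `S = [n] ∖ V(AA)` (no internal edge of `H`, `b` crossing edges, cut `t−2f−g` of
either parity, reduced level `c − g`), the crossing-plane form `ψ(2f+g+X)·(2λ(X−Y) + L − κc)²` with `λ = u₁−u₀`, `κ = u₀`,
`L = 2u₂f + u₀(t−2f)` (lit `crossingWeight_containment_eq`), weighted by the class polynomial `p_{fg}(c)` (degree `a`, vanishing at
the virtual level unless `g = 0`, vanishing on the levels `c < g`; T-K4b `classWeight`). This file prices exactly that object:

* **`tiltedSmallBlock_levelSum_le`**: for an exact design `(n,t,T,D,B_v,C,w)` (its rule), a stable `S` with `N'` edges, a block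
  `H` with no edge of `S` inside and `b` crossing edges, reduced cut `2s₀+c₀` (`c₀ ≤ 1`), shift `g ≤ T` and base `2i₀+1 = g+c₀`,
  `R ≥ 1`, `R + 3(D′+1) + b + (T−1)/2 ≤ s₀`, `R + 3(D′+1) + b + s₀ + (T−1)/2 + 2 ≤ N'`, `(b/R)²e^{3b/R} ≤ 2`, mask `0 ≤ ψ ≤ G` on
  `[0,2s₀+c₀]`, `|λ| ≤ 2`, `|κ| ≤ 1`, `|L| ≤ L₀`, weight `p` with `deg p + 2 + D′ ≤ D`, `p(0) ≥ 0`, `p(0) = 0` unless `g = 0`,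
  `p = 0` on the levels `< g`, `|p| ≤ P` on the levels:
  `Σ_c w_c p(c)·E_{Shell_S(2s₀+c₀, c−g)}[ψ(X)(2λ(X−Y)+L−κc)²] ≤ B_v·P·C((T−1)/2, D′+1)·G·(4(2s₀+c₀)+L₀+5T+4)²·(¼(b/R)²e^{3b/R})^{D′+1}`.
  Proof: 151b `levelSum_tilted_expand` ∘ 151a `piece_main_le` (the `ψ₀`-piece when `g = 0`: virtual value `≥ 0`, T-K4b §2) /
  `piece_abs_le` (all other pieces: their level weights vanish at the virtual level, and below their base by PARITY) on the ground
  sets `S`, `S∖e_v`, `S∖e_v∖e_w`; smoothness from `ShellLawSmallBlockSmoothness`; `|S∩H| ≤ |S|`, `Σ_v |(S∩H)∖e_v| ≤ |S|(|S|−2)`.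
READING (MEMO-33 §1): with `a = 0`, `S = [n]`, `g = 0`, `p = 1` this is already «(CG_1′) for a small block without internal matching
edge in every type-constant direction, per matching, EFFECTIVE» (tilted companion of T-K2); bricks 152/153 (class split on `[n]`,
`M`-average) feed bricks 148 §4 / 150b. WHAT THIS FILE DOES NOT DO: the class split, the `M`-average, directions outside the
type-constant ones; anything on `TracialDecayExp20` itself, psd rank of P_PM(K_n), or P vs NP.
[cite: Rothvoss2017, §2 (PDF p. 6)] [cite: Agarwal2000DifferenceEquations, Remark 1.8.1 (1.8.8)] [cite: RollinRoss2010, §3 (Lemma 3.1)]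
Stature: support/instrument (kernel lane, no defs, axioms standard; one `maxHeartbeats 400000`, passes at 300000). Supports stmt-PneNP-19878.
-/

set_option linter.dupNamespace false -- `Summit.PneNP.PneNP.…`: summit = sub-problem (D-0017)

noncomputable section

namespace Summit.PneNP.PneNP.Theorems.ChebyshevTracialDesignTiltedSmallBlock

open Finset Polynomial Literature.Barriers.PneNP Literature.Combinatorics.Optimization
open Literature.Combinatorics.Optimization.ShellStep
open Summit.PneNP.PneNP.Theorems.ChebyshevTracialDesignTiltedSmallBlockTools
open Summit.PneNP.PneNP.Theorems.ChebyshevTracialDesignTiltedSmallBlockExpansion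

variable {n : ℕ}

section Main

variable {π : Fin n → Fin n} (hπ : ∀ v, π (π v) = v) (hπ' : ∀ v, π v ≠ v)
include hπ hπ'

set_option maxHeartbeats 400000 in
/-- **TILTED SMALL BLOCKS, ONE `HH`-CLASS: THE CROSSING-PLANE FORM PRICED (brick 151).** Exact design `(n,t,T,D,B_v,C,w)`
(only its rule is used); a `π`-stable ground set `S` with `N'` edges; a block `H` with NO edge of `S` inside and `b`
crossing edges; the reduced cut `2s₀+c₀` (`c₀ ≤ 1`), a level shift `g ≤ T` and base `i₀` with `2i₀+1 = g+c₀`; `R ≥ 1`,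
`R + 3(D′+1) + b + (T−1)/2 ≤ s₀`, `R + 3(D′+1) + b + s₀ + (T−1)/2 + 2 ≤ N'`, `(b/R)²e^{3b/R} ≤ 2`; a mask `0 ≤ ψ ≤ G` on
`[0, 2s₀+c₀]`; crossing-plane data `|λ| ≤ 2`, `|κ| ≤ 1`, `|L| ≤ L₀`; a polynomial level weight `p` with `deg p + 2 + D′ ≤ D`,
`p(0) ≥ 0`, `p(0) = 0` unless `g = 0`, `p(c) = 0` on the levels `c < g`, `|p| ≤ P` on the levels. Then
`Σ_c w_c p(c)·E_{Shell_S(2s₀+c₀, c−g)}[ψ(X)·(2λ(X−Y) + L − κc)²] ≤ B_v·P·C((T−1)/2, D′+1)·G·(4(2s₀+c₀)+L₀+5T+4)²·(¼(b/R)²e^{3b/R})^{D′+1}`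
(`X = |U∩H|`, `Y = |half U ∩ H|`). Seven pieces (§5–§6): the main piece `ψ₀ = ψ(2λX+L)²` is priced one-sidedly (§4
`piece_main_le`, virtual value `≥ 0`) when `g = 0` and is pure remainder otherwise; the six others have level weights vanishing
at the virtual level (`c`, `c²`, `c−g`, `c(c−g)`, `(c−g)(c−g−1)` times `p`) and are pure remainders on `S`, `S∖e_v`, `S∖e_v∖e_w`
(§4 `piece_abs_le`, smoothness from `ShellLawSmallBlockSmoothness`). [cite: Rothvoss2017, §2 (PDF p. 6)]
[cite: Agarwal2000DifferenceEquations, Remark 1.8.1 (1.8.8)] [cite: RollinRoss2010, §3 (Lemma 3.1)] -/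
theorem tiltedSmallBlock_levelSum_le {t T D : ℕ} {Bv : ℝ} {C : Finset ℕ} {w : ℕ → ℝ}
    (hdes : IsExactDesign n t T D Bv C w)
    {S : Finset (Fin n)} (hS : ∀ v ∈ S, π v ∈ S) {N' : ℕ} (hN : S.card = 2 * N')
    (H : Finset (Fin n)) (h0 : (reps π (vAA π S H)).card = 0)
    {b : ℕ} (hb : (reps π (vBH π S H ∪ vBN π S H)).card = b)
    {s₀ c₀ i₀ g D' R : ℕ} (hc₀ : c₀ ≤ 1) (hi₀ : 2 * i₀ + 1 = g + c₀) (hgT : g ≤ T) (hR : 1 ≤ R)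
    (hR1 : R + 3 * (D' + 1) + b + (T - 1) / 2 ≤ s₀)
    (hR2 : R + 3 * (D' + 1) + b + s₀ + (T - 1) / 2 + 2 ≤ N')
    (hq : ((b : ℝ) / R) ^ 2 * Real.exp (3 * b / R) ≤ 2)
    (ψ : ℤ → ℝ) {G : ℝ} (hG : ∀ x ∈ Icc (0 : ℤ) ((2 * s₀ + c₀ : ℕ) : ℤ), |ψ x| ≤ G)
    (hψ0 : ∀ x ∈ Icc (0 : ℤ) ((2 * s₀ + c₀ : ℕ) : ℤ), 0 ≤ ψ x)
    (lam kap L : ℝ) {L₀ : ℝ} (hlam : |lam| ≤ 2) (hkap : |kap| ≤ 1) (hL : |L| ≤ L₀)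
    (p : ℝ[X]) (hdeg : p.natDegree + 2 + D' ≤ D) (hp0 : 0 ≤ p.eval 0) (hpg : g ≠ 0 → p.eval 0 = 0)
    (hpC : ∀ c ∈ C, c < g → p.eval (c : ℝ) = 0) {P : ℝ} (hP : ∀ c ∈ C, |p.eval (c : ℝ)| ≤ P) :
    ∑ c ∈ C, w c * (p.eval (c : ℝ) *
        ((∑ U ∈ shellIn π S (2 * s₀ + c₀) (c - g), ψ ((U ∩ H).card : ℤ) *
            (2 * lam * (((U ∩ H).card : ℝ) - ((half π U ∩ H).card : ℝ)) + L - kap * c) ^ 2) /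
          ((shellIn π S (2 * s₀ + c₀) (c - g)).card : ℝ))) ≤
      Bv * P * ((((T - 1) / 2).choose (D' + 1) : ℕ) : ℝ) *
        (G * (4 * ((2 * s₀ + c₀ : ℕ) : ℝ) + L₀ + 5 * T + 4) ^ 2 *
          ((1 / 4 : ℝ) * ((b : ℝ) / R) ^ 2 * Real.exp (3 * b / R)) ^ (D' + 1)) := by
  classical
  -- basic facts
  set q : ℝ := (1 / 4 : ℝ) * ((b : ℝ) / R) ^ 2 * Real.exp (3 * b / R) with hqdef
  have hq0 : 0 ≤ q := by rw [hqdef]; positivity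
  set Kc : ℝ := ((((T - 1) / 2).choose (D' + 1) : ℕ) : ℝ) with hKc
  have hKc0 : 0 ≤ Kc := Nat.cast_nonneg _
  have hG0 : 0 ≤ G := (abs_nonneg _).trans (hG 0 (mem_Icc.2 ⟨le_rfl, by positivity⟩))
  have hBv : 0 ≤ Bv := (sum_nonneg fun c _ => abs_nonneg (w c)).trans hdes.variation_le
  obtain ⟨c₁, hc₁⟩ : C.Nonempty := by
    by_contra h
    have := hdes.2.2.2.2.1
    rw [not_nonempty_iff_eq_empty.1 h, sum_empty] at this
    exact zero_ne_one this
  have hP0 : 0 ≤ P := (abs_nonneg _).trans (hP c₁ hc₁)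
  have hlev : ∀ c ∈ C, (∃ j, c = 2 * j + 1) ∧ 3 ≤ c ∧ c ≤ T := by
    intro c hc
    obtain ⟨hodd, h3, hcT, _⟩ := hdes.2.2.2.1 c hc
    exact ⟨hodd.imp fun j hj => by omega, h3, hcT⟩
  have hT0 : (0 : ℝ) ≤ T := Nat.cast_nonneg T
  have hnoHH := noHH_of_card_reps_vAA_eq_zero hπ hπ' hS H h0
  have hScard : (4 : ℝ) ≤ S.card := by exact_mod_cast (show 4 ≤ S.card by omega)
  have hL₀ : 0 ≤ L₀ := (abs_nonneg _).trans hL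
  set Λ₁ : ℝ := 4 * ((2 * s₀ + c₀ : ℕ) : ℝ) + L₀ with hΛ₁
  have hΛ₁0 : 0 ≤ Λ₁ := by rw [hΛ₁]; positivity
  -- masks
  have hlin : ∀ x : ℤ, x ∈ Icc (0 : ℤ) ((2 * s₀ + c₀ : ℕ) : ℤ) → |2 * lam * (x : ℝ) + L| ≤ Λ₁ := by
    intro x hx
    obtain ⟨hx0, hx1⟩ := mem_Icc.1 hx
    have hx0' : (0 : ℝ) ≤ x := by exact_mod_cast hx0
    have hx1' : (x : ℝ) ≤ ((2 * s₀ + c₀ : ℕ) : ℝ) := by exact_mod_cast hx1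
    have h1 : |2 * lam * (x : ℝ)| ≤ 4 * ((2 * s₀ + c₀ : ℕ) : ℝ) := by
      rw [abs_mul, abs_mul, abs_two, abs_of_nonneg hx0']
      have := mul_le_mul (mul_le_mul_of_nonneg_left hlam zero_le_two) hx1' hx0' (by norm_num)
      linarith only [this]
    rw [hΛ₁]
    exact (abs_add_le _ _).trans (add_le_add h1 hL)
  have hψ1 : ∀ x ∈ Icc (0 : ℤ) ((2 * s₀ + c₀ : ℕ) : ℤ), |ψ x * (2 * lam * (x : ℝ) + L)| ≤ G * Λ₁ := by
    intro x hx
    rw [abs_mul]; exact mul_le_mul (hG x hx) (hlin x hx) (abs_nonneg _) hG0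
  have hψ2 : ∀ x ∈ Icc (0 : ℤ) ((2 * s₀ + c₀ : ℕ) : ℤ), |ψ x * (2 * lam * (x : ℝ) + L) ^ 2| ≤ G * Λ₁ ^ 2 := by
    intro x hx
    rw [abs_mul, abs_pow]; exact mul_le_mul (hG x hx) (pow_le_pow_left₀ (abs_nonneg _) (hlin x hx) 2) (by positivity) hG0
  have hψ2' : ∀ x ∈ Icc (0 : ℤ) ((2 * s₀ + c₀ : ℕ) : ℤ), 0 ≤ ψ x * (2 * lam * (x : ℝ) + L) ^ 2 :=
    fun x hx => mul_nonneg (hψ0 x hx) (sq_nonneg _)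
  -- nonempty shells at the levels `c ≥ g + 1`
  have hne : ∀ c ∈ C, g + 1 ≤ c → (shellIn π S (2 * s₀ + c₀) (c - g)).Nonempty := by
    intro c hc hgc
    obtain ⟨⟨j, rfl⟩, _, hcT⟩ := hlev c hc
    have h := shellIn_nonempty_of_add_le hπ hπ' hS hN (s := s₀ + i₀ - j) (c := 2 * j + 1 - g) (by omega)
    rwa [show 2 * (s₀ + i₀ - j) + (2 * j + 1 - g) = 2 * s₀ + c₀ by omega] at h
  -- a level below the base is not a design level (parity)
  have hbase : ∀ c ∈ C, c < g + c₀ → p.eval (c : ℝ) = 0 := by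
    intro c hc hlt
    obtain ⟨⟨j, rfl⟩, _, _⟩ := hlev c hc
    rcases lt_or_ge (2 * j + 1) g with h | h
    · exact hpC _ hc h
    · exfalso; omega
  have hp0g : p.eval 0 * (g : ℝ) = 0 := by
    rcases Nat.eq_zero_or_pos g with h | h
    · rw [h, Nat.cast_zero, mul_zero]
    · rw [hpg (by omega), zero_mul]
  -- degrees and level bounds of the five derived weights
  obtain ⟨hdX, hdX2, hdg, hdXg, hdgg⟩ := weights_natDegree_le p (g : ℝ) ((g : ℝ) + 1) hdeg
  have hgT' : (g : ℝ) ≤ T := by exact_mod_cast hgT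
  obtain ⟨hPX, hPX2, hPg, hPXg, hPgg⟩ := weights_abs_eval_le p C hP hP0 (Nat.cast_nonneg g) hgT'
    (fun c hc => by obtain ⟨_, h3, hcT⟩ := hlev c hc; exact ⟨by exact_mod_cast h3, by exact_mod_cast hcT⟩)
  -- expand
  have ht2 : 2 ≤ 2 * s₀ + c₀ := by omega
  rw [levelSum_tilted_expand hπ hπ' hS H ht2 g C w p hpC hne ψ lam kap L]
  -- ground-set data of the deleted instances
  have hSv : ∀ v ∈ S ∩ H, (∀ u ∈ S \ {v, π v}, π u ∈ S \ {v, π v}) ∧ (S \ {v, π v}).card = 2 * (N' - 1) ∧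
      (reps π (vAA π (S \ {v, π v}) H)).card = 0 ∧
      (reps π (vBH π (S \ {v, π v}) H ∪ vBN π (S \ {v, π v}) H)).card ≤ b := by
    intro v hv
    have hvS : v ∈ S := (mem_inter.1 hv).1
    have hc := card_sdiff_pair hπ' hS hvS
    exact ⟨sdiff_pair_stable hπ hS v, by omega, reps_vAA_card_eq_zero_of_subset sdiff_subset H h0,
      hb ▸ reps_vB_card_le_of_subset sdiff_subset H⟩
  have hSvw : ∀ v ∈ S ∩ H, ∀ w' ∈ (S ∩ H) \ {v, π v},
      (∀ u ∈ del2 π S v w', π u ∈ del2 π S v w') ∧ (del2 π S v w').card = 2 * (N' - 2) ∧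
      (reps π (vAA π (del2 π S v w') H)).card = 0 ∧
      (reps π (vBH π (del2 π S v w') H ∪ vBN π (del2 π S v w') H)).card ≤ b := by
    intro v hv w' hw'
    have hvS : v ∈ S := (mem_inter.1 hv).1
    rw [mem_sdiff, mem_inter, mem_insert, mem_singleton, not_or] at hw'
    have hc := card_del2 hπ hπ' hS hvS hw'.1.1 hw'.2.1 hw'.2.2
    rw [hN] at hc
    push_cast at hc
    have hc' : (del2 π S v w').card = 2 * (N' - 2) := by
      have h4 : (4 : ℝ) ≤ 2 * (N' : ℝ) := by
        have : (2 : ℝ) ≤ N' := by exact_mod_cast (show 2 ≤ N' by omega)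
        linarith
      have e : ((del2 π S v w').card : ℝ) = ((2 * (N' - 2) : ℕ) : ℝ) := by
        rw [hc, Nat.cast_mul, Nat.cast_sub (by omega)]; push_cast; ring
      exact_mod_cast e
    have hsub : del2 π S v w' ⊆ S := by intro u hu; exact (mem_del2.1 hu).1
    exact ⟨del2_stable hπ hS v w', hc', reps_vAA_card_eq_zero_of_subset hsub H h0,
      hb ▸ reps_vB_card_le_of_subset hsub H⟩
  -- the reduced cut one vertex down: `2s₀ + c₀ − 1 = 2s₁ + c₁`, base `i₁`
  obtain ⟨s₁, c₁, i₁, hs₁, hi₁, hc₁, hs₁le⟩ : ∃ s₁ c₁ i₁ : ℕ, 2 * s₀ + c₀ - 1 = 2 * s₁ + c₁ ∧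
      2 * i₁ + 1 = g + 1 + c₁ ∧ c₁ ≤ 1 ∧ s₁ ≤ s₀ ∧ s₀ ≤ s₁ + 1 := by
    rcases Nat.eq_zero_or_pos c₀ with h | h
    · exact ⟨s₀ - 1, 1, i₀ + 1, by omega, by omega, le_rfl, by omega, by omega⟩
    · exact ⟨s₀, 0, i₀, by omega, by omega, by omega, le_rfl, by omega⟩
  -- === T0: the main piece
  have hB0 : ∑ c ∈ C, w c * (p.eval (c : ℝ) *
      ((∑ U ∈ shellIn π S (2 * s₀ + c₀) (c - g), (fun x : ℤ => ψ x * (2 * lam * (x : ℝ) + L) ^ 2) ((U ∩ H).card : ℤ)) /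
        ((shellIn π S (2 * s₀ + c₀) (c - g)).card : ℝ))) ≤ Bv * P * Kc * (G * Λ₁ ^ 2 * q ^ (D' + 1)) := by
    rcases Nat.eq_zero_or_pos g with hg0 | hgpos
    · subst hg0
      have hc₀1 : c₀ = 1 := by omega
      subst hc₀1
      simp only [Nat.sub_zero]
      have h := piece_main_le hπ hπ' hdes hS hN H h0 hb le_rfl (s₀ := s₀) (D' := D') hR (by omega) (by omega) hq
        (fun x : ℤ => ψ x * (2 * lam * (x : ℝ) + L) ^ 2) hψ2 hψ2' p (by omega) hp0 hP
      rw [← hqdef, ← hKc] at h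
      exact h
    · have hpz : p.eval 0 = 0 := hpg (by omega)
      have h := piece_abs_le hπ hπ' hdes hS hN H h0 hb le_rfl (D' := D') hi₀ hR (by omega) (by omega)
        (fun x : ℤ => ψ x * (2 * lam * (x : ℝ) + L) ^ 2) hψ2 p (by omega) hpz
        (fun c hc hlt => hbase c hc (by omega)) hP
      rw [← hqdef, ← hKc] at h
      exact (le_abs_self _).trans h
  -- === T1, T2: plain pieces with weights `p·c`, `p·c²`
  have hB1 : |∑ c ∈ C, w c * ((p * X).eval (c : ℝ) *
      ((∑ U ∈ shellIn π S (2 * s₀ + c₀) (c - g), (fun x : ℤ => ψ x * (2 * lam * (x : ℝ) + L)) ((U ∩ H).card : ℤ)) /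
        ((shellIn π S (2 * s₀ + c₀) (c - g)).card : ℝ)))| ≤ Bv * (P * T) * Kc * (G * Λ₁ * q ^ (D' + 1)) := by
    have h := piece_abs_le hπ hπ' hdes hS hN H h0 hb le_rfl hi₀ hR (by omega) (by omega)
      (fun x : ℤ => ψ x * (2 * lam * (x : ℝ) + L)) hψ1 (p * X) hdX (by simp)
      (fun c hc hlt => by rw [eval_mul, hbase c hc (by omega), zero_mul]) hPX
    rw [← hqdef, ← hKc] at h
    exact h
  have hB2 : |∑ c ∈ C, w c * ((p * X ^ 2).eval (c : ℝ) *
      ((∑ U ∈ shellIn π S (2 * s₀ + c₀) (c - g), ψ ((U ∩ H).card : ℤ)) /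
        ((shellIn π S (2 * s₀ + c₀) (c - g)).card : ℝ)))| ≤ Bv * (P * T ^ 2) * Kc * (G * q ^ (D' + 1)) := by
    have h := piece_abs_le hπ hπ' hdes hS hN H h0 hb le_rfl hi₀ hR (by omega) (by omega)
      ψ hG (p * X ^ 2) hdX2 (by simp)
      (fun c hc hlt => by rw [eval_mul, hbase c hc (by omega), zero_mul]) hPX2
    rw [← hqdef, ← hKc] at h
    exact h
  -- === T3, T4, T5: one half vertex pinned (ground set `S ∖ e_v`, cut `2s₁+c₁`, shift `g+1`, base `i₁`)
  have hshift1 : ∀ x ∈ Icc (0 : ℤ) ((2 * s₁ + c₁ : ℕ) : ℤ), x + 1 ∈ Icc (0 : ℤ) ((2 * s₀ + c₀ : ℕ) : ℤ) := by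
    intro x hx
    rw [mem_Icc] at hx ⊢
    constructor
    · omega
    · have : ((2 * s₁ + c₁ : ℕ) : ℤ) + 1 ≤ ((2 * s₀ + c₀ : ℕ) : ℤ) := by push_cast; omega
      omega
  have hψ1s : ∀ x ∈ Icc (0 : ℤ) ((2 * s₁ + c₁ : ℕ) : ℤ),
      |(fun x : ℤ => ψ (x + 1) * (2 * lam * ((x + 1 : ℤ) : ℝ) + L)) x| ≤ G * Λ₁ :=
    fun x hx => hψ1 (x + 1) (hshift1 x hx)
  have hψs : ∀ x ∈ Icc (0 : ℤ) ((2 * s₁ + c₁ : ℕ) : ℤ), |(fun x : ℤ => ψ (x + 1)) x| ≤ G :=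
    fun x hx => hG (x + 1) (hshift1 x hx)
  have hwg0 : (p * (X - Polynomial.C (g : ℝ))).eval 0 = 0 := by
    rw [eval_mul, eval_sub, eval_X, eval_C, zero_sub, mul_neg, hp0g, neg_zero]
  have hwXg0 : (p * X * (X - Polynomial.C (g : ℝ))).eval 0 = 0 := by simp
  have hbase1 : ∀ c ∈ C, c < 2 * i₁ + 1 → (p * (X - Polynomial.C (g : ℝ))).eval (c : ℝ) = 0 := by
    intro c hc hlt
    obtain ⟨⟨j, rfl⟩, _, _⟩ := hlev c hc
    rcases lt_trichotomy (2 * j + 1) g with h | h | h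
    · rw [eval_mul, hpC _ hc h, zero_mul]
    · rw [eval_mul, eval_sub, eval_X, eval_C, ← h]; push_cast; ring
    · exfalso; omega
  have hbase1' : ∀ c ∈ C, c < 2 * i₁ + 1 → (p * X * (X - Polynomial.C (g : ℝ))).eval (c : ℝ) = 0 := by
    intro c hc hlt
    have h := hbase1 c hc hlt
    rw [eval_mul] at h
    rw [eval_mul, eval_mul, eval_X, mul_assoc, mul_comm (c : ℝ), ← mul_assoc, h, zero_mul]
  have hB3 : ∀ v ∈ S ∩ H, |∑ c ∈ C, w c * ((p * (X - Polynomial.C (g : ℝ))).eval (c : ℝ) *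
      ((∑ W ∈ shellIn π (S \ {v, π v}) (2 * s₀ + c₀ - 1) (c - g - 1),
          (fun x : ℤ => ψ (x + 1) * (2 * lam * ((x + 1 : ℤ) : ℝ) + L)) ((W ∩ H).card : ℤ)) /
        ((shellIn π (S \ {v, π v}) (2 * s₀ + c₀ - 1) (c - g - 1)).card : ℝ)))| ≤
      Bv * (P * T) * Kc * (G * Λ₁ * q ^ (D' + 1)) := by
    intro v hv
    obtain ⟨hst, hcard, h0v, hbv⟩ := hSv v hv
    have h := piece_abs_le hπ hπ' hdes hst hcard H h0v rfl hbv hi₁ hR (by omega) (by omega)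
      _ hψ1s (p * (X - Polynomial.C (g : ℝ))) hdg hwg0 hbase1 hPg
    rw [← hqdef, ← hKc, ← hs₁] at h
    simp only [Nat.sub_sub] at h ⊢
    exact h
  have hB4 : ∀ v ∈ S ∩ H, |∑ c ∈ C, w c * ((p * X * (X - Polynomial.C (g : ℝ))).eval (c : ℝ) *
      ((∑ W ∈ shellIn π (S \ {v, π v}) (2 * s₀ + c₀ - 1) (c - g - 1), (fun x : ℤ => ψ (x + 1)) ((W ∩ H).card : ℤ)) /
        ((shellIn π (S \ {v, π v}) (2 * s₀ + c₀ - 1) (c - g - 1)).card : ℝ)))| ≤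
      Bv * (P * T ^ 2) * Kc * (G * q ^ (D' + 1)) := by
    intro v hv
    obtain ⟨hst, hcard, h0v, hbv⟩ := hSv v hv
    have h := piece_abs_le hπ hπ' hdes hst hcard H h0v rfl hbv hi₁ hR (by omega) (by omega)
      _ hψs (p * X * (X - Polynomial.C (g : ℝ))) hdXg hwXg0 hbase1' hPXg
    rw [← hqdef, ← hKc, ← hs₁] at h
    simp only [Nat.sub_sub] at h ⊢
    exact h
  have hB5 : ∀ v ∈ S ∩ H, |∑ c ∈ C, w c * ((p * (X - Polynomial.C (g : ℝ))).eval (c : ℝ) *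
      ((∑ W ∈ shellIn π (S \ {v, π v}) (2 * s₀ + c₀ - 1) (c - g - 1), (fun x : ℤ => ψ (x + 1)) ((W ∩ H).card : ℤ)) /
        ((shellIn π (S \ {v, π v}) (2 * s₀ + c₀ - 1) (c - g - 1)).card : ℝ)))| ≤
      Bv * (P * T) * Kc * (G * q ^ (D' + 1)) := by
    intro v hv
    obtain ⟨hst, hcard, h0v, hbv⟩ := hSv v hv
    have h := piece_abs_le hπ hπ' hdes hst hcard H h0v rfl hbv hi₁ hR (by omega) (by omega)
      _ hψs (p * (X - Polynomial.C (g : ℝ))) hdg hwg0 hbase1 hPg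
    rw [← hqdef, ← hKc, ← hs₁] at h
    simp only [Nat.sub_sub] at h ⊢
    exact h
  -- === T6: two half vertices pinned (ground set `S ∖ e_v ∖ e_w`, cut `2(s₀−1)+c₀`, shift `g+2`, base `i₀+1`)
  have hshift2 : ∀ x ∈ Icc (0 : ℤ) ((2 * (s₀ - 1) + c₀ : ℕ) : ℤ), x + 2 ∈ Icc (0 : ℤ) ((2 * s₀ + c₀ : ℕ) : ℤ) := by
    intro x hx
    rw [mem_Icc] at hx ⊢
    constructor
    · omega
    · have : ((2 * (s₀ - 1) + c₀ : ℕ) : ℤ) + 2 ≤ ((2 * s₀ + c₀ : ℕ) : ℤ) := by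
        have : 1 ≤ s₀ := by omega
        push_cast [Nat.cast_sub this]; omega
      omega
  have hψss : ∀ x ∈ Icc (0 : ℤ) ((2 * (s₀ - 1) + c₀ : ℕ) : ℤ), |(fun x : ℤ => ψ (x + 2)) x| ≤ G :=
    fun x hx => hG (x + 2) (hshift2 x hx)
  have hwgg0 : (p * (X - Polynomial.C (g : ℝ)) * (X - Polynomial.C ((g : ℝ) + 1))).eval 0 = 0 := by
    rw [eval_mul, hwg0, zero_mul]
  have hbase2 : ∀ c ∈ C, c < 2 * (i₀ + 1) + 1 →
      (p * (X - Polynomial.C (g : ℝ)) * (X - Polynomial.C ((g : ℝ) + 1))).eval (c : ℝ) = 0 := by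
    intro c hc hlt
    obtain ⟨⟨j, rfl⟩, _, _⟩ := hlev c hc
    rcases lt_trichotomy (2 * j + 1) (g + 1) with h | h | h
    · rw [eval_mul, hbase1 _ hc (by omega), zero_mul]
    · rw [eval_mul, eval_sub, eval_X, eval_C, show ((2 * j + 1 : ℕ) : ℝ) = (g : ℝ) + 1 by exact_mod_cast h]
      ring
    · exfalso; omega
  have hB6 : ∀ v ∈ S ∩ H, ∀ w' ∈ (S ∩ H) \ {v, π v},
      |∑ c ∈ C, w c * ((p * (X - Polynomial.C (g : ℝ)) * (X - Polynomial.C ((g : ℝ) + 1))).eval (c : ℝ) *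
      ((∑ W ∈ shellIn π (del2 π S v w') (2 * s₀ + c₀ - 2) (c - g - 2), (fun x : ℤ => ψ (x + 2)) ((W ∩ H).card : ℤ)) /
        ((shellIn π (del2 π S v w') (2 * s₀ + c₀ - 2) (c - g - 2)).card : ℝ)))| ≤
      Bv * (P * T ^ 2) * Kc * (G * q ^ (D' + 1)) := by
    intro v hv w' hw'
    obtain ⟨hst, hcard, h0v, hbv⟩ := hSvw v hv w' hw'
    have hi₂ : 2 * (i₀ + 1) + 1 = (g + 2) + c₀ := by omega
    have h := piece_abs_le hπ hπ' hdes hst hcard H h0v rfl hbv hi₂ hR (by omega) (by omega)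
      _ hψss (p * (X - Polynomial.C (g : ℝ)) * (X - Polynomial.C ((g : ℝ) + 1))) hdgg hwgg0 hbase2 hPgg
    rw [← hqdef, ← hKc, show 2 * (s₀ - 1) + c₀ = 2 * s₀ + c₀ - 2 by omega] at h
    simp only [Nat.sub_sub] at h ⊢
    exact h
  -- === sums over the pinned vertices
  have hSpos : (0 : ℝ) < S.card := by linarith only [hScard]
  have hVle : ((S ∩ H).card : ℝ) ≤ S.card := by exact_mod_cast card_le_card inter_subset_left
  have hD0 : (0 : ℝ) < (S.card : ℝ) * ((S.card : ℝ) - 2) := mul_pos hSpos (by linarith only [hScard])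
  have hpairs : (∑ v ∈ S ∩ H, ((((S ∩ H) \ {v, π v}).card : ℕ) : ℝ)) ≤ (S.card : ℝ) * ((S.card : ℝ) - 2) := by
    have h1 : ∀ v ∈ S ∩ H, ((S ∩ H) \ {v, π v}).card ≤ (S ∩ H).card - 1 := by
      intro v hv
      have : (S ∩ H) \ {v, π v} ⊆ (S ∩ H).erase v := by
        intro u hu
        rw [mem_sdiff, mem_insert, not_or] at hu
        exact mem_erase.2 ⟨hu.2.1, hu.1⟩
      exact (card_le_card this).trans (by rw [card_erase_of_mem hv])
    have h2 : ∑ v ∈ S ∩ H, ((S ∩ H) \ {v, π v}).card ≤ S.card * (S.card - 2) :=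
      calc ∑ v ∈ S ∩ H, ((S ∩ H) \ {v, π v}).card ≤ ∑ v ∈ S ∩ H, ((S ∩ H).card - 1) := sum_le_sum h1
        _ = (S ∩ H).card * ((S ∩ H).card - 1) := by rw [sum_const, smul_eq_mul]
        _ ≤ (S.card - 1) * (S.card - 2) := card_inter_mul_pred_le hS H hnoHH (by omega)
        _ ≤ S.card * (S.card - 2) := Nat.mul_le_mul_right _ (Nat.sub_le _ _)
    have h3 : ((∑ v ∈ S ∩ H, ((S ∩ H) \ {v, π v}).card : ℕ) : ℝ) ≤ ((S.card * (S.card - 2) : ℕ) : ℝ) := by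
      exact_mod_cast h2
    rw [Nat.cast_sum, Nat.cast_mul, Nat.cast_sub (by omega)] at h3
    simpa using h3
  have h4abs : |(4 : ℝ)| = 4 := abs_of_pos (by norm_num)
  have hl4' : |4 * lam| ≤ 8 := by rw [abs_mul, h4abs]; linarith only [hlam]
  have hlk : |4 * lam * kap| ≤ 8 := by
    rw [abs_mul, abs_mul, h4abs]
    have h1 : |lam| * |kap| ≤ 2 * 1 := mul_le_mul hlam hkap (abs_nonneg _) (by norm_num)
    linarith only [h1]
  have hll : |4 * lam ^ 2| ≤ 16 := by
    rw [abs_mul, abs_pow, h4abs]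
    have h1 : |lam| ^ 2 ≤ 2 ^ 2 := pow_le_pow_left₀ (abs_nonneg lam) hlam 2
    linarith only [h1]
  have hK3 := abs_div_mul_sum_le (S ∩ H) _ (by positivity) hB3 hSpos hVle hl4'
  have hK4 := abs_div_mul_sum_le (S ∩ H) _ (by positivity) hB4 hSpos hVle hlk
  have hK5 := abs_div_mul_sum_le (S ∩ H) _ (by positivity) hB5 hSpos hVle hll
  have hK6 := abs_div_mul_sum_sum_le (S ∩ H) (fun v => (S ∩ H) \ {v, π v}) _ (by positivity) hB6 hD0 hpairs hll
  -- === the scalar pieces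
  have hK1 : |2 * kap * ∑ c ∈ C, w c * ((p * X).eval (c : ℝ) *
      ((∑ U ∈ shellIn π S (2 * s₀ + c₀) (c - g), (fun x : ℤ => ψ x * (2 * lam * (x : ℝ) + L)) ((U ∩ H).card : ℤ)) /
        ((shellIn π S (2 * s₀ + c₀) (c - g)).card : ℝ)))| ≤ 2 * (Bv * (P * T) * Kc * (G * Λ₁ * q ^ (D' + 1))) := by
    rw [abs_mul, abs_mul, abs_of_pos (by norm_num : (0:ℝ) < 2)]
    have : 2 * |kap| ≤ 2 := by linarith only [hkap]
    exact mul_le_mul this hB1 (abs_nonneg _) (by norm_num)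
  have hK2 : |kap ^ 2 * ∑ c ∈ C, w c * ((p * X ^ 2).eval (c : ℝ) *
      ((∑ U ∈ shellIn π S (2 * s₀ + c₀) (c - g), ψ ((U ∩ H).card : ℤ)) /
        ((shellIn π S (2 * s₀ + c₀) (c - g)).card : ℝ)))| ≤ 1 * (Bv * (P * T ^ 2) * Kc * (G * q ^ (D' + 1))) := by
    rw [abs_mul, abs_pow]
    have : |kap| ^ 2 ≤ 1 := pow_le_one₀ (abs_nonneg _) hkap
    exact mul_le_mul this hB2 (abs_nonneg _) (by norm_num)
  -- === assembly
  have hpoly : Λ₁ ^ 2 + 10 * T * Λ₁ + 25 * T ^ 2 + 16 * T ≤ (Λ₁ + 5 * T + 4) ^ 2 := by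
    have e : (Λ₁ + 5 * T + 4) ^ 2 = Λ₁ ^ 2 + 10 * T * Λ₁ + 25 * T ^ 2 + 16 * T + (16 + 8 * Λ₁ + 24 * T) := by ring
    rw [e]; linarith only [hΛ₁0, hT0]
  have hM0 : 0 ≤ Bv * P * Kc * G * q ^ (D' + 1) := by positivity
  have hsum : Bv * P * Kc * (G * Λ₁ ^ 2 * q ^ (D' + 1)) + 2 * (Bv * (P * T) * Kc * (G * Λ₁ * q ^ (D' + 1)))
      + 1 * (Bv * (P * T ^ 2) * Kc * (G * q ^ (D' + 1))) + 8 * (Bv * (P * T) * Kc * (G * Λ₁ * q ^ (D' + 1)))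
      + 8 * (Bv * (P * T ^ 2) * Kc * (G * q ^ (D' + 1))) + 16 * (Bv * (P * T) * Kc * (G * q ^ (D' + 1)))
      + 16 * (Bv * (P * T ^ 2) * Kc * (G * q ^ (D' + 1))) ≤
      Bv * P * Kc * (G * (Λ₁ + 5 * T + 4) ^ 2 * q ^ (D' + 1)) := by
    have e1 : Bv * P * Kc * (G * Λ₁ ^ 2 * q ^ (D' + 1)) + 2 * (Bv * (P * T) * Kc * (G * Λ₁ * q ^ (D' + 1)))
      + 1 * (Bv * (P * T ^ 2) * Kc * (G * q ^ (D' + 1))) + 8 * (Bv * (P * T) * Kc * (G * Λ₁ * q ^ (D' + 1)))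
      + 8 * (Bv * (P * T ^ 2) * Kc * (G * q ^ (D' + 1))) + 16 * (Bv * (P * T) * Kc * (G * q ^ (D' + 1)))
      + 16 * (Bv * (P * T ^ 2) * Kc * (G * q ^ (D' + 1))) =
        Bv * P * Kc * G * q ^ (D' + 1) * (Λ₁ ^ 2 + 10 * T * Λ₁ + 25 * T ^ 2 + 16 * T) := by ring
    have e2 : Bv * P * Kc * (G * (Λ₁ + 5 * T + 4) ^ 2 * q ^ (D' + 1)) =
        Bv * P * Kc * G * q ^ (D' + 1) * (Λ₁ + 5 * T + 4) ^ 2 := by ring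
    rw [e1, e2]
    exact mul_le_mul_of_nonneg_left hpoly hM0
  linarith only [hB0, (abs_le.1 hK1).1, (abs_le.1 hK2).2, (abs_le.1 hK3).1, (abs_le.1 hK4).2, (abs_le.1 hK5).2,
    (abs_le.1 hK6).2, hsum]

end Main

end Summit.PneNP.PneNP.Theorems.ChebyshevTracialDesignTiltedSmallBlock

end
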